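import Literature.Claims.NS.LucardoOlivaes2026
import Literature.Analysis.FluidPDE.AxisymmetricNoSwirlGlobalHolds
import Literature.Analysis.FluidPDE.AxisymNoSwirlTaoBounds
import Literature.Analysis.FluidPDE.ClassicalSobolevUniqueness
import HarnessLib

/-!
# D-0090 NS-CLAIMS, claim C137 `LucardoOlivaes2026` — the claimed conclusion is impossible on the printed
# axisymmetric swirl-free sub-class (downstream / STATEMENT-subclass companion; kernel lane)

Cell `ns-claims`; companion by `ns-claims-refuter-5` (g3) on the chair's GO (lead-1 g4, RULINGS 08:42Z (1),
2026-08-27), for the row of refuter of record `ns-claims-refuter-2` (typist `ns-claims-typist-10` g4, referee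
`ns-claims-ref-1` g4, filer `ns-claims-salvage-p4` g3); literature pointer credited to `ns-claims-lit-2` g4
(UG-LIT afb4ac2ee06d14e1 §(1c)/§(3α), RECORDED 08:35Z (1)). Source: J. R. Lucardo Olivaes, Zenodo
10.5281/zenodo.21815761 (2026), 3 pp.; skeleton `Literature.Claims.NS.LucardoOlivaes2026` (rev 4, p513667).

CONTENT. The print's claimed conclusion is `EnstrophyDiverges u T` («enstrophy diverges in finite time»,
abstract p.1 l.15–16, §6 p.3 l.12–15) for a regular local solution from the §3 datum. The §3 construction
(p.2 l.13–17: two coaxial anti-parallel vortex rings «in cylindrical coordinates (r, θ, z)» with velocity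
`(u_r, u_z)`) is of the AXISYMMETRIC SWIRL-FREE kind. For EVERY datum of the skeleton's analytic class
(`Chae2007.IsDatum`: `C^∞`, divergence free, every derivative in `L²`) which is axisymmetric without swirl
(tree predicates `IsAxisymmetric`, `HasNoSwirl`), and every `ν > 0`, the conclusion is impossible along EVERY
regular local solution (`Chae2007.IsLocalSolution`, the BKM class) on every horizon `T`:

* `exists_ensq_le_of_noSwirl` — one constant bounds `‖ω(t)‖²_{L²}` on `[0, T)`;
* `not_enstrophyDiverges_of_noSwirl : 0 < ν → IsDatum v₀ → IsAxisymmetric v₀ → HasNoSwirl v₀ →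
  IsLocalSolution ν T v₀ u p → ¬ EnstrophyDiverges u T` (the chair's signature);
* `not_enstrophyDiverges_of_isOuroDatum_noSwirl` — the same at the claim's own vocabulary `IsOuroDatum`
  (projection `IsOuroDatum v₀ → IsDatum v₀`), restated as a fully-qualified `example` at the end of the file;
* `not_exists_divergence_of_noSwirl` — per `ν > 0`, NO axisymmetric swirl-free Ouroboros-class datum launches a
  regular local solution with diverging enstrophy (the shape of `ClaimedTheorem` restricted to the sub-class).

ASSEMBLY (no new analysis; three PROVED tree theorems): (i) global regularity of axisymmetric swirl-free
`H^∞` data (Ladyzhenskaya 1968 / Ukhovskii–Yudovich 1968; Lemarié-Rieusset 2016 Thm. 10.4) in the form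
`exists_isTaoSolutionOn_of_noSwirl` fed with `tao2011_smooth_local_existence_holds` and
`axisymmetricNoSwirl_enstrophy_apriori_holds`: a Tao-class solution on the CLOSED slab `[0, T]` whose `L²`
Sobolev norms are bounded by one constant; (ii) uniqueness in the BKM class on closed slabs,
`MajdaBertozzi2002_uniquenessSobolev_holds` (Majda–Bertozzi 2002 Cor. 3.1) — exactly the skeleton's solution
class, no pressure or `L²`-continuity hypothesis — applied on `[0, S]`, `t ≤ S < T`; (iii) `‖ω‖²_{L²} ≤
‖curl‖² ‖Du‖²_{L²}` (`integrable_norm_curl_sq`).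

SCOPE (chair's caveat, verbatim in substance): the typed `IsOuroGeometry` does not force rotation invariance,
so this bears on the print's axisymmetric members, not on the token of record (6) = `Step6GI_StretchLower`
(class unfilled gap, ADJUDICATED #120), which is untouched; no claim decl is negated here — the file BOUNDS the
printed sub-class (category: conclusion-false-on-printed-subclass).

WHAT THIS IS NOT: not a claim about NS regularity or blow-up; not a claim about any author beyond the typed
locator.
-/

-- The summit's canonical theorem namespace repeats the summit name (single-conjunct summit).
set_option linter.dupNamespace false

noncomputable section

open Set MeasureTheory
open scoped ContDiff ENNReal NNReal

namespace Summit.NavierStokesRegularity.NavierStokesRegularity.Theorems.LucardoOlivaes2026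

open Literature.Analysis.FluidPDE
open Literature.Claims.NS.Chae2007 (IsDatum IsLocalSolution)
open Literature.Claims.NS.LucardoOlivaes2026

variable {ν T : ℝ} {v₀ : E3 → E3} {u : ℝ → E3 → E3} {p : ℝ → E3 → ℝ}

/-- **Bounded enstrophy on the printed sub-class.** For `ν > 0`, an `H^∞` divergence-free datum `v₀` which is
axisymmetric without swirl, and ANY regular local solution `(u, p)` from `v₀` on `[0, T) × ℝ³` (BKM class),
one constant bounds `‖curl u(t)‖²_{L²}` on `[0, T)`: the global Tao-class solution `w` from `v₀` on `[0, T]`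
(`exists_isTaoSolutionOn_of_noSwirl`) has `∫‖Dw(t)‖² ≤ C` there, `u(t) = w(t)` for `t < T` by BKM-class
uniqueness on `[0, (t+T)/2]` (`MajdaBertozzi2002_uniquenessSobolev_holds`), and `∫|curl w(t)|² ≤ ‖curl‖²·C`
(`integrable_norm_curl_sq`). [cite: LemarieRieusset2016, Thm. 10.4 (p. 285), with Thm. 7.3 (p. 149)] [cite: MajdaBertozzi2002, Cor. 3.1 (p. 88)] [cite: LucardoOlivaes2026, §3 p.2 l.13–17; §6 p.3 l.12–15] -/
theorem exists_ensq_le_of_noSwirl (hν : 0 < ν) (hD : IsDatum v₀) (haxi : IsAxisymmetric v₀)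
    (hsw : HasNoSwirl v₀) (hu : IsLocalSolution ν T v₀ u p) :
    ∃ M : ℝ, ∀ t ∈ Ico 0 T, ensq u t ≤ M := by
  rcases le_or_gt T 0 with hT | hT
  · exact ⟨0, fun t ht => absurd (ht.1.trans_lt (ht.2.trans_le hT)) (lt_irrefl 0)⟩
  obtain ⟨hsm, hdiv, hH⟩ := hD
  obtain ⟨w, q, hw⟩ := exists_isTaoSolutionOn_of_noSwirl tao2011_smooth_local_existence_holds
    axisymmetricNoSwirl_enstrophy_apriori_holds hν hsm hdiv hH haxi hsw hT
  obtain ⟨C, hC⟩ := hw.sobolev 1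
  refine ⟨‖curlCLM‖ ^ 2 * (C : ℝ), fun t ht => ?_⟩
  -- uniqueness in the BKM class on the closed slab `[0, S]`, `t ≤ S < T`
  set S : ℝ := (t + T) / 2 with hS
  have htS : t ≤ S := by rw [hS]; linarith [ht.2]
  have hST : S < T := by rw [hS]; linarith [ht.2]
  have hS0 : 0 < S := lt_of_le_of_lt ht.1 (by rw [hS]; linarith [ht.2])
  have hu' : IsClassicalNSSolutionOn (Icc 0 S) ν 0 u p :=
    hu.isClassical.mono (Icc_subset_Ico_right hST) (uniqueDiffOn_Icc hS0)
  have hw' : IsClassicalNSSolutionOn (Icc 0 S) ν 0 w q :=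
    hw.classical.mono (Icc_subset_Icc_right hST.le) (uniqueDiffOn_Icc hS0)
  have heq : u t = w t :=
    MajdaBertozzi2002_uniquenessSobolev_holds hν.le hS0 hu' hw' (hu.sobolev S hST)
      (hw.sobolev.mono (Icc_subset_Icc_right hST.le)) (by rw [hu.initial, hw.initial]) t ⟨ht.1, htS⟩
  -- the enstrophy of the Tao-class slice is bounded by its `n = 1` Sobolev bound
  have htT : t ∈ Icc 0 T := ⟨ht.1, ht.2.le⟩
  have hct2 : ContDiff ℝ 2 (w t) := (hw.classical.contDiff_velocity htT).of_le (by norm_cast)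
  have h1 : ∫⁻ x, ‖iteratedFDeriv ℝ 1 (w t) x‖ₑ ^ 2 < ⊤ := (hC t htT).trans_lt ENNReal.coe_lt_top
  unfold ensq
  rw [heq]
  exact (integrable_norm_curl_sq hct2 h1).2.trans
    (mul_le_mul_of_nonneg_left (ENNReal.toReal_le_coe_of_le_coe (hC t htT)) (sq_nonneg _))

/-- **The claimed conclusion is impossible on the printed axisymmetric swirl-free sub-class** (chair's
signature, RULINGS 08:42Z (1)): conclusion `EnstrophyDiverges` impossible for every axisymmetric swirl-free
datum of the analytic class, at every `ν > 0`, along every regular local solution on every horizon — the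
print's §3 construction p.2 l.13–17 is of this kind (cylindrical `(r, θ, z)`, velocity `(u_r, u_z)`); scope:
the typed `IsOuroGeometry` does not force axisymmetry; token (6) / class UG untouched.
[cite: LucardoOlivaes2026, abstract p.1 l.15–16; §3 p.2 l.13–17; §6 p.3 l.12–15] [cite: LemarieRieusset2016, Thm. 10.4 (p. 285)] [cite: MajdaBertozzi2002, Cor. 3.1 (p. 88)] -/
theorem not_enstrophyDiverges_of_noSwirl (hν : 0 < ν) (hD : IsDatum v₀) (haxi : IsAxisymmetric v₀)
    (hsw : HasNoSwirl v₀) (hu : IsLocalSolution ν T v₀ u p) : ¬ EnstrophyDiverges u T := by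
  obtain ⟨M, hM⟩ := exists_ensq_le_of_noSwirl hν hD haxi hsw hu
  intro h
  obtain ⟨t, ht, hlt⟩ := h M
  exact absurd (hM t ht) (not_le.mpr hlt)

/-- The same at the claim's own vocabulary: for every datum of the typed Ouroboros class `IsOuroDatum`
(projection onto its analytic part `IsDatum`) which is axisymmetric without swirl, no regular local solution
has diverging enstrophy. [cite: LucardoOlivaes2026, §3 p.2 l.12–26; §6 p.3 l.12–15] -/
theorem not_enstrophyDiverges_of_isOuroDatum_noSwirl (hν : 0 < ν) (hD : IsOuroDatum v₀)
    (haxi : IsAxisymmetric v₀) (hsw : HasNoSwirl v₀) (hu : IsLocalSolution ν T v₀ u p) :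
    ¬ EnstrophyDiverges u T :=
  not_enstrophyDiverges_of_noSwirl hν hD.1 haxi hsw hu

/-- **`ClaimedTheorem` restricted to the printed sub-class fails at every `ν > 0`**: there is NO axisymmetric
swirl-free datum of the Ouroboros class launching a regular local solution whose enstrophy diverges at a
positive horizon. [cite: LucardoOlivaes2026, abstract p.1 l.8–16; §3 p.2 l.13–17; §6 p.3 l.12–15] -/
theorem not_exists_divergence_of_noSwirl (hν : 0 < ν) :
    ¬ ∃ v₀ : E3 → E3, IsOuroDatum v₀ ∧ IsAxisymmetric v₀ ∧ HasNoSwirl v₀ ∧ ∃ T : ℝ, 0 < T ∧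
      ∃ (u : ℝ → E3 → E3) (p : ℝ → E3 → ℝ), IsLocalSolution ν T v₀ u p ∧ EnstrophyDiverges u T := by
  rintro ⟨v₀, hD, haxi, hsw, T, -, u, p, hu, hdiv⟩
  exact not_enstrophyDiverges_of_isOuroDatum_noSwirl hν hD haxi hsw hu hdiv

end Summit.NavierStokesRegularity.NavierStokesRegularity.Theorems.LucardoOlivaes2026

/-- Fully-qualified restatement at the claim's vocabulary (read-back aid). [cite: LucardoOlivaes2026, §3 p.2 l.13–17; §6 p.3 l.12–15] -/
example : ∀ ν : ℝ, 0 < ν → ∀ v₀ : Literature.Claims.NS.LucardoOlivaes2026.E3 → Literature.Claims.NS.LucardoOlivaes2026.E3,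
    Literature.Claims.NS.LucardoOlivaes2026.IsOuroDatum v₀ → Literature.Analysis.FluidPDE.IsAxisymmetric v₀ →
    Literature.Analysis.FluidPDE.HasNoSwirl v₀ → ∀ (T : ℝ) (u : ℝ → _ → _) (p : ℝ → _ → ℝ),
    Literature.Claims.NS.Chae2007.IsLocalSolution ν T v₀ u p →
    ¬ Literature.Claims.NS.LucardoOlivaes2026.EnstrophyDiverges u T :=
  fun _ hν _ hD haxi hsw _ _ _ hu =>
    Summit.NavierStokesRegularity.NavierStokesRegularity.Theorems.LucardoOlivaes2026.not_enstrophyDiverges_of_isOuroDatum_noSwirl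
      hν hD haxi hsw hu

end
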